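import Summits.FinalStateConjecture.FinalStateConjecture.Theorems.EIHFluxBalanceModulatedKerrHandoffBentLabChartAux1
import Summits.FinalStateConjecture.FinalStateConjecture.Theorems.SwallowTheDatumUniversalWitnessFamilyRegionOneHoleChart
import Literature.Geometry.Lorentzian.GaussianBeamPhase
import Literature.Geometry.Lorentzian.KerrWaveDecay
import Literature.Geometry.Lorentzian.KerrSchildCoord
import HarnessLib

set_option linter.dupNamespace false

/-!
# Stub `stub_bentLabLeaf` (T2b) of line `swallow-transfer`, crux `EIHFluxBalance.ModulatedKerrHandoff` (stmt-FinalStateConjecture-10167)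

Support file for crux `stmt-FinalStateConjecture-10167`
(`Summit.FinalStateConjecture.FinalStateConjecture.Theses.EIHFluxBalance.ModulatedKerrHandoff`), line
`swallow-transfer`: the registered stub `stub_bentLabLeaf` (statement VERBATIM from the registered skeleton
`Cruxes/ModulatedKerrHandoff/Lines/swallow_transfer.lean`).

**The bent lab chart.** `f(x) = x + Θ(x) e₀` with the shift `Θ(x) = χ₁(|x̲|/x⁰ − 1) · T(|x̲|)`
(`χ₁ = Real.smoothTransition`, `T = bentHeight M a`, `|x̲| = E4.spatialNorm x`, `e₀ = E4.basisVector 0`):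
a Kerr–Schild time translation depending on lab time. This file proves, for sub-extremal `(M, a)` and every
`τ₀ ≥ τb := 2048 M`, the set-theoretic half of stub T2:

* (i) every point of the half-space `{x⁰ > τ₀}` is mapped strictly ABOVE the data leaf `{x⁰ = T(r)}`:
  `T(r x) < (f x)⁰` (`r ≤ |x̲|`, `Kerr.radius_le_spatialNorm`; `T` monotone; `Θ = T(|x̲|)` once `|x̲| ≥ 2x⁰`
  and `T(|x̲|) ≤ T(2x⁰) < x⁰` otherwise, `SwallowTransfer.bentHeight_two_mul_lt`);
* (ii) `f` preserves the spatial point and the Kerr–Schild radius, and `(f x)⁰ = x⁰ + Θ(x)`;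
* (iii) `f` maps the late set `{x⁰ > t₁, r > r₀}` (`t₁ ≥ τ₀`) onto the epigraph `{y⁰ > t₁ + Θ(t₁, |y̲|), r > r₀}`
  and (iv) the slab `{x⁰ = t₁, r > r₀}` onto the graph `{y⁰ = t₁ + Θ(t₁, |y̲|), r > r₀}`: `f` preserves the time
  fibres `{x̲ = const}` and on the fibre over `x̲`, `ρ = |x̲|`, it is the fibre map `s ↦ s + χ₁(ρ/s − 1) T(ρ)`,
  strictly increasing on `[2048 M, ∞)` (`SwallowTransfer.strictMonoOn_fibreMap`) with all intermediate values
  (`SwallowTransfer.exists_fibreMap_eq`).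

References: Dafermos–Rodnianski arXiv:0811.0354, §5.1 (ingoing Kerr–Schild chart, the leaf height);
elementary real analysis otherwise.
-/

noncomputable section

open scoped Manifold ContDiff Topology
open Set Filter Literature.Geometry.Lorentzian
open Literature.Geometry.Lorentzian.GaussianBeam (apply_zero_add_smul_basisVector_zero)
open Summit.FinalStateConjecture.FinalStateConjecture.Theorems.KerrShieldedDataExist.Negative
  (bentHeight mass_pos)
open Summit.FinalStateConjecture.FinalStateConjecture.Theorems.SwallowTheDatum.UniversalWitnessFamily
  (spatialNorm_add_smul_basisVector)

namespace Summit.FinalStateConjecture.FinalStateConjecture.Cruxes.ModulatedKerrHandoff.SwallowTransfer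

section BentLabLeaf

variable {M a : ℝ}

/-! ## Time translations `x ↦ x + c e₀`

The time coordinate of `x + c e₀` is `x⁰ + c` (`GaussianBeam.apply_zero_add_smul_basisVector_zero`), its spatial
part and spatial radius are those of `x` (`Kerr.spatial_add_smul_basisVector_zero`,
`UniversalWitnessFamily.spatialNorm_add_smul_basisVector`), and so is its Kerr–Schild radius
(`Kerr.radius_add_time_smul_basisVector`). -/

/-- Undoing a time translation: `(x + (−c) e₀) + c e₀ = x`. [folklore] -/
theorem add_neg_smul_add_smul_basisVector_zero (x : E4) (c : ℝ) :
    x + (-c) • E4.basisVector 0 + c • E4.basisVector 0 = x := by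
  rw [add_assoc, ← add_smul, neg_add_cancel, zero_smul, add_zero]

/-! ## (i) every late point is mapped strictly above the data leaf -/

/-- **(i)** For `x⁰ ≥ 32 M`: `T(r x) < (f x)⁰ = x⁰ + χ₁(|x̲|/x⁰ − 1) T(|x̲|)`.  Indeed `T(r x) ≤ T(|x̲|)`
(`r ≤ |x̲|`, `T` monotone); if `|x̲| ≥ 2x⁰` the cutoff is `1` and `(f x)⁰ = x⁰ + T(|x̲|) > T(|x̲|)`;
otherwise `T(|x̲|) ≤ T(2x⁰) < x⁰ ≤ (f x)⁰`. [folklore] -/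
theorem bentHeight_radius_lt_bentLab_apply_zero (h : |a| < M) {x : E4} (hx : 32 * M ≤ x 0) :
    bentHeight M a (Kerr.radius a x) <
      (x + (Real.smoothTransition (E4.spatialNorm x / x 0 - 1) *
        bentHeight M a (E4.spatialNorm x)) • E4.basisVector 0) 0 := by
  have hM := mass_pos h
  have hx0 : 0 < x 0 := lt_of_lt_of_le (by positivity) hx
  rw [apply_zero_add_smul_basisVector_zero]
  have h1 : bentHeight M a (Kerr.radius a x) ≤ bentHeight M a (E4.spatialNorm x) :=
    monotone_bentHeight h (Kerr.radius_le_spatialNorm a x)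
  rcases le_or_gt (2 * x 0) (E4.spatialNorm x) with h2 | h2
  · rw [fibreShift_eq_of_two_mul_le hx0 h2]
    linarith
  · have h3 : bentHeight M a (E4.spatialNorm x) ≤ bentHeight M a (2 * x 0) :=
      monotone_bentHeight h h2.le
    have h4 := bentHeight_two_mul_lt h hx
    have h5 := fibreShift_nonneg h (x 0) (E4.spatialNorm x)
    linarith

/-! ## (iv) images of slabs -/

/-- **(iv)** `f` maps the slab `{x⁰ = t₁, r > r₀}` onto the graph `{y⁰ = t₁ + χ₁(|y̲|/t₁ − 1) T(|y̲|), r > r₀}`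
(no lateness needed: `f` preserves the fibres, and on the slab the shift only depends on `|x̲| = |y̲|`).
[folklore] -/
theorem image_bentLab_slab (M a t₁ r₀ : ℝ) :
    (fun x : E4 ↦ x + (Real.smoothTransition (E4.spatialNorm x / x 0 - 1) *
        bentHeight M a (E4.spatialNorm x)) • E4.basisVector 0) '' {x : E4 | x 0 = t₁ ∧ r₀ < Kerr.radius a x} =
      {y : E4 | y 0 = t₁ + Real.smoothTransition (E4.spatialNorm y / t₁ - 1) * bentHeight M a (E4.spatialNorm y) ∧
        r₀ < Kerr.radius a y} := by
  ext y
  constructor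
  · rintro ⟨x, ⟨hx0, hxr⟩, rfl⟩
    refine ⟨?_, ?_⟩
    · rw [apply_zero_add_smul_basisVector_zero, spatialNorm_add_smul_basisVector, hx0]
    · show r₀ < Kerr.radius a (x + _ • E4.basisVector 0)
      rwa [Kerr.radius_add_time_smul_basisVector]
  · rintro ⟨hy0, hyr⟩
    refine ⟨y + (-(Real.smoothTransition (E4.spatialNorm y / t₁ - 1) *
      bentHeight M a (E4.spatialNorm y))) • E4.basisVector 0, ⟨?_, ?_⟩, ?_⟩
    · rw [apply_zero_add_smul_basisVector_zero, hy0, add_neg_cancel_right]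
    · show r₀ < Kerr.radius a (y + _ • E4.basisVector 0)
      rwa [Kerr.radius_add_time_smul_basisVector]
    · show y + _ • E4.basisVector 0 + _ • E4.basisVector 0 = y
      rw [spatialNorm_add_smul_basisVector, apply_zero_add_smul_basisVector_zero, hy0,
        add_neg_cancel_right]
      exact add_neg_smul_add_smul_basisVector_zero y _

/-! ## (iii) images of late sets -/

/-- **(iii)** For `t₁ ≥ 2048 M`, `f` maps the late set `{x⁰ > t₁, r > r₀}` onto the epigraph
`{y⁰ > t₁ + χ₁(|y̲|/t₁ − 1) T(|y̲|), r > r₀}`: on the fibre over `y̲`, `ρ = |y̲|`, `f` is the fibre map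
`s ↦ s + χ₁(ρ/s − 1) T(ρ)`, strictly increasing on `[2048 M, ∞)` (`strictMonoOn_fibreMap`) and taking every
value above `t₁ + χ₁(ρ/t₁ − 1) T(ρ)` at some `s > t₁` (`exists_fibreMap_eq`). [folklore] -/
theorem image_bentLab_late (h : |a| < M) {t₁ : ℝ} (ht₁ : 2048 * M ≤ t₁) (r₀ : ℝ) :
    (fun x : E4 ↦ x + (Real.smoothTransition (E4.spatialNorm x / x 0 - 1) *
        bentHeight M a (E4.spatialNorm x)) • E4.basisVector 0) '' {x : E4 | t₁ < x 0 ∧ r₀ < Kerr.radius a x} =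
      {y : E4 | t₁ + Real.smoothTransition (E4.spatialNorm y / t₁ - 1) * bentHeight M a (E4.spatialNorm y) < y 0 ∧
        r₀ < Kerr.radius a y} := by
  have hM := mass_pos h
  have ht0 : 0 < t₁ := lt_of_lt_of_le (by positivity) ht₁
  ext y
  constructor
  · rintro ⟨x, ⟨hx0, hxr⟩, rfl⟩
    refine ⟨?_, ?_⟩
    · rw [apply_zero_add_smul_basisVector_zero, spatialNorm_add_smul_basisVector]
      exact strictMonoOn_fibreMap h (E4.spatialNorm x) (show 2048 * M ≤ t₁ from ht₁)
        (show 2048 * M ≤ x 0 by linarith) hx0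
    · show r₀ < Kerr.radius a (x + _ • E4.basisVector 0)
      rwa [Kerr.radius_add_time_smul_basisVector]
  · rintro ⟨hy0, hyr⟩
    obtain ⟨s, hs, hsY⟩ := exists_fibreMap_eq h ht0 (E4.spatialNorm y) (y 0) hy0
    refine ⟨y + (s - y 0) • E4.basisVector 0, ⟨?_, ?_⟩, ?_⟩
    · show t₁ < (y + (s - y 0) • E4.basisVector 0) 0
      rw [apply_zero_add_smul_basisVector_zero]
      linarith
    · show r₀ < Kerr.radius a (y + _ • E4.basisVector 0)
      rwa [Kerr.radius_add_time_smul_basisVector]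
    · show y + _ • E4.basisVector 0 + _ • E4.basisVector 0 = y
      rw [spatialNorm_add_smul_basisVector, apply_zero_add_smul_basisVector_zero,
        add_sub_cancel, add_assoc, ← add_smul]
      have : s - y 0 + Real.smoothTransition (E4.spatialNorm y / s - 1) * bentHeight M a (E4.spatialNorm y) = 0 := by
        linarith
      rw [this, zero_smul, add_zero]

end BentLabLeaf

/-- **T2b `stub_bentLabLeaf`.** For sub-extremal `(M, a)` and `rin > r₋` there is `τb > 0` (`τb = 2048 M`) such that
for every `τ₀ ≥ τb`: (i) `f` maps every point of `{x⁰ > τ₀}` strictly ABOVE the data leaf, `T(r x) < (f x)⁰`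
(`bentHeight_radius_lt_bentLab_apply_zero`: `T(r) ≤ T(|x̲|)`, `Θ = T(|x̲|)` for `|x̲| ≥ 2x⁰`, and
`T(|x̲|) ≤ T(2x⁰) < x⁰ ≤ (f x)⁰` for `|x̲| < 2x⁰`, `x⁰ ≥ 32M`); (ii) `f` preserves the spatial point, hence the
Kerr radius, and `(f x)⁰ = x⁰ + Θ(x)` (definitional unfolding); (iii)/(iv) `f` maps the late sets
`{x⁰ > t₁, r > r₀}` onto the epigraphs `{y⁰ > t₁ + Θ(t₁, |y̲|), r > r₀}` (`image_bentLab_late`) and the slabs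
`{x⁰ = t₁, r > r₀}` onto the graphs `{y⁰ = t₁ + Θ(t₁, |y̲|), r > r₀}` (`image_bentLab_slab`). The hypothesis
`r₋ < rin` is not needed. [folklore] -/
theorem stub_bentLabLeaf : ∀ (M a rin : ℝ), |a| < M → Kerr.rMinus M a < rin →
    ∃ τb : ℝ, 0 < τb ∧ ∀ τ₀ : ℝ, τb ≤ τ₀ →
      (∀ x : E4, τ₀ < x 0 → bentHeight M a (Kerr.radius a x) <
        ((fun x : E4 ↦ x + (Real.smoothTransition (E4.spatialNorm x / x 0 - 1) *
            bentHeight M a (E4.spatialNorm x)) • E4.basisVector 0) x) 0) ∧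
      (∀ x : E4,
        E4.spatial ((fun x : E4 ↦ x + (Real.smoothTransition (E4.spatialNorm x / x 0 - 1) *
            bentHeight M a (E4.spatialNorm x)) • E4.basisVector 0) x) = E4.spatial x ∧
        Kerr.radius a ((fun x : E4 ↦ x + (Real.smoothTransition (E4.spatialNorm x / x 0 - 1) *
            bentHeight M a (E4.spatialNorm x)) • E4.basisVector 0) x) = Kerr.radius a x ∧
        ((fun x : E4 ↦ x + (Real.smoothTransition (E4.spatialNorm x / x 0 - 1) *
            bentHeight M a (E4.spatialNorm x)) • E4.basisVector 0) x) 0 = x 0 + Real.smoothTransition (E4.spatialNorm x / x 0 - 1) * bentHeight M a (E4.spatialNorm x)) ∧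
      (∀ t₁ : ℝ, τ₀ ≤ t₁ → ∀ r₀ : ℝ, rin ≤ r₀ →
        (fun x : E4 ↦ x + (Real.smoothTransition (E4.spatialNorm x / x 0 - 1) *
            bentHeight M a (E4.spatialNorm x)) • E4.basisVector 0) '' {x : E4 | t₁ < x 0 ∧ r₀ < Kerr.radius a x} =
          {y : E4 | t₁ + Real.smoothTransition (E4.spatialNorm y / t₁ - 1) * bentHeight M a (E4.spatialNorm y) < y 0 ∧
            r₀ < Kerr.radius a y}) ∧
      (∀ t₁ : ℝ, τ₀ < t₁ → ∀ r₀ : ℝ, rin ≤ r₀ →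
        (fun x : E4 ↦ x + (Real.smoothTransition (E4.spatialNorm x / x 0 - 1) *
            bentHeight M a (E4.spatialNorm x)) • E4.basisVector 0) '' {x : E4 | x 0 = t₁ ∧ r₀ < Kerr.radius a x} =
          {y : E4 | y 0 = t₁ + Real.smoothTransition (E4.spatialNorm y / t₁ - 1) * bentHeight M a (E4.spatialNorm y) ∧
            r₀ < Kerr.radius a y}) := by
  intro M a rin h _
  have hM := mass_pos h
  refine ⟨2048 * M, by positivity, fun τ₀ hτ₀ ↦ ⟨fun x hx ↦ ?_, fun x ↦ ⟨?_, ?_, ?_⟩,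
    fun t₁ ht₁ r₀ _ ↦ image_bentLab_late h (hτ₀.trans ht₁) r₀, fun t₁ _ r₀ _ ↦ image_bentLab_slab M a t₁ r₀⟩⟩
  · exact bentHeight_radius_lt_bentLab_apply_zero h (show 32 * M ≤ x 0 by linarith)
  · exact Kerr.spatial_add_smul_basisVector_zero x _
  · exact Kerr.radius_add_time_smul_basisVector a x _
  · exact apply_zero_add_smul_basisVector_zero x _

end Summit.FinalStateConjecture.FinalStateConjecture.Cruxes.ModulatedKerrHandoff.SwallowTransfer

end
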